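import Mathlib
import HarnessLib
import Summits.CriticalPhenomena.PercolationContinuityZ3.Theorems.PercNearOneGluingNoHeavyLowerTailAntipodalSubmodularKernel

/-!
# Antipodal dominance without nestedness, the case-I cell poset of `Γ`, and the star-split induction principle

Helper file for crux `stmt-CriticalPhenomena-4575` (`NoHeavyLowerTail`), factory seat `prim-ineq-gen-2`
(gen 4).  Everything here is PROVED; no route definition is touched.  Memo:
`run/shared/lean/prim/prim-ineq-gen-2/COMB-GAMMA.md` (§2, §4).

Context.  `Γ = AG − u₃(n+n′)` (HMAX-SPLIT) has the tensor-Bernstein ("antipodal") expansion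
`2Γ(G;p) = Σ_{α⊆β} μ(α)μ(β) A(α,β)`, `A(α,β) = Σ_{R ⊆ β∖α} κ(cell(α∪R), cell(β∖R))`, so `A ≥ 0` for all
intervals gives `Γ ≥ 0` for all weights.  The machine of
`PercNearOneGluingNoHeavyLowerTailAntipodalSubmodularKernel` needs a kernel that is box-submodular on the
whole cell poset; the kernel of `Γ` is not (two defect boxes), but it IS on the sub-poset of cells met by
configurations in which `a ≁ c` ("case I"), and the proof of the STAR-SPLIT reduction (memo §4, (P2)) needs
the following three abstract facts, proved here:

* `antipodalSum_ge_diag`: for a kernel `κ` that is submodular on comparable rectangles of a preorder `Q`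
  and two monotone (NOT necessarily nested) maps `g h : Finset α → Q`,
  `Σ_{X ⊆ S} κ (g X) (h X) ≤ Σ_{X ⊆ S} κ (g X) (h (S ∖ X))` — the diagonal pairing is dominated by the
  antipodal pairing.  (Same one-coordinate rearrangement as the nested theorem; no chain-nonnegativity.)
* `CellI`: the five cells `W, N′, U1, U3, M` reachable when `a ≁ c`, with the order generated by the
  one-edge moves at the star of `b` (`W ≤ U1, U3, M`, `N′ ≤ U1, M`, `U1 ≤ M`, `U3 ≤ M`; NOT `N′ ≤ U3`,
  and `W`, `N′` incomparable: the separation flag does not depend on the edges at `b`), and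
  the kernel of `Γ` restricted to them (`+1` on `{W,N′} × {M}`, `−1` on `{U1,U3}` and `{N′,U3}`); it is
  submodular on comparable rectangles (`kappaI_submod`, 625 cases by `decide`), whence
  `caseI_starTerm_nonneg`: the same-case star-deficit term `Σ_V [κ(φ V, ψ (S∖V)) − κ(φ V, ψ V)] ≥ 0`.
* `starInduction`: the abstract induction principle behind "STAR-SPLIT LEMMA ⟹ A ≥ 0 for all intervals":
  if every interval either has `A ≥ 0` outright or admits a nonempty set `T` of free coordinates with
  `A(α,D) ≥ Σ_{V ⊆ T} A(α ∪ V, D ∖ T)`, then `A ≥ 0` everywhere (strong induction on `|D|`).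
-/

namespace Summit.CriticalPhenomena.PercolationContinuityZ3.Theorems

namespace AntipodalDominance

open Finset

variable {α : Type*} [DecidableEq α] {Q : Type*} {R : Type*}

/-- **Antipodal dominance.**  If `κ a₁ b₁ + κ a₀ b₀ ≤ κ a₁ b₀ + κ a₀ b₁` whenever `a₀ ≤ a₁`, `b₀ ≤ b₁`,
then for all monotone `g h : Finset α → Q` (no nestedness assumed) and every finite `S`,
`Σ_{X ⊆ S} κ (g X) (h X) ≤ Σ_{X ⊆ S} κ (g X) (h (S ∖ X))`. [new] -/
theorem antipodalSum_ge_diag [Preorder Q] [AddCommGroup R] [PartialOrder R] [IsOrderedAddMonoid R]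
    (κ : Q → Q → R)
    (hsub : ∀ a₀ a₁ b₀ b₁ : Q, a₀ ≤ a₁ → b₀ ≤ b₁ → κ a₁ b₁ + κ a₀ b₀ ≤ κ a₁ b₀ + κ a₀ b₁)
    (S : Finset α) :
    ∀ g h : Finset α → Q, (∀ ⦃X Y : Finset α⦄, X ⊆ Y → g X ≤ g Y) →
      (∀ ⦃X Y : Finset α⦄, X ⊆ Y → h X ≤ h Y) →
        ∑ X ∈ S.powerset, κ (g X) (h X) ≤ ∑ X ∈ S.powerset, κ (g X) (h (S \ X)) := by
  induction S using Finset.induction_on with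
  | empty =>
    intro g h _ _
    simp only [powerset_empty, sum_singleton, sdiff_self]
    exact le_refl _
  | insert a S ha ih =>
    intro g h hg hh
    rw [AntipodalSubmodularKernel.antipodalSum_insert κ ha, sum_powerset_insert ha]
    have key : ∑ X ∈ S.powerset, κ (g X) (h (S \ X)) +
        ∑ X ∈ S.powerset, κ (g (insert a X)) (h (insert a (S \ X))) ≤
        ∑ X ∈ S.powerset, κ (g X) (h (insert a (S \ X))) +
          ∑ X ∈ S.powerset, κ (g (insert a X)) (h (S \ X)) := by
      rw [← sum_add_distrib, ← sum_add_distrib]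
      refine sum_le_sum fun X _ => ?_
      have h1 : g X ≤ g (insert a X) := hg (subset_insert a X)
      have h2 : h (S \ X) ≤ h (insert a (S \ X)) := hh (subset_insert a _)
      have := hsub _ _ _ _ h1 h2
      rw [add_comm (κ (g X) (h (insert a (S \ X)))), add_comm (κ (g X) (h (S \ X)))]
      exact this
    have ih₀ := ih g h hg hh
    have ih₁ := ih (fun X => g (insert a X)) (fun X => h (insert a X))
      (fun _ _ hXY => hg (insert_subset_insert a hXY)) (fun _ _ hXY => hh (insert_subset_insert a hXY))
    have hih₁ : ∑ X ∈ S.powerset, κ (g (insert a X)) (h (insert a X)) ≤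
        ∑ X ∈ S.powerset, κ (g (insert a X)) (h (insert a (S \ X))) := ih₁
    calc ∑ X ∈ S.powerset, κ (g X) (h X) + ∑ X ∈ S.powerset, κ (g (insert a X)) (h (insert a X))
        ≤ ∑ X ∈ S.powerset, κ (g X) (h (S \ X)) +
            ∑ X ∈ S.powerset, κ (g (insert a X)) (h (insert a (S \ X))) := add_le_add ih₀ hih₁
      _ ≤ _ := key

/-- Corollary in "deficit" form: `0 ≤ Σ_{X ⊆ S} (κ (g X) (h (S ∖ X)) − κ (g X) (h X))`. -/
theorem starTerm_nonneg [Preorder Q] [AddCommGroup R] [PartialOrder R] [IsOrderedAddMonoid R]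
    (κ : Q → Q → R)
    (hsub : ∀ a₀ a₁ b₀ b₁ : Q, a₀ ≤ a₁ → b₀ ≤ b₁ → κ a₁ b₁ + κ a₀ b₀ ≤ κ a₁ b₀ + κ a₀ b₁)
    (S : Finset α) (g h : Finset α → Q) (hg : ∀ ⦃X Y : Finset α⦄, X ⊆ Y → g X ≤ g Y)
    (hh : ∀ ⦃X Y : Finset α⦄, X ⊆ Y → h X ≤ h Y) :
    0 ≤ ∑ X ∈ S.powerset, (κ (g X) (h (S \ X)) - κ (g X) (h X)) := by
  rw [sum_sub_distrib, sub_nonneg]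
  exact antipodalSum_ge_diag κ hsub S g h hg hh

/-! ### The case-I cell poset of `Γ` at the star of `b` -/

/-- The five refined cells that occur while `a ≁ c`: `W` (a|b|c, non-separating), `Np` (= N′: a|b|c with
`V(C_a)` separating `b` from `c` in the support), `U1` (ab|c), `U3` (bc|a), `M` (abc with `b ~ c` avoiding `a`). -/
inductive CellI
  | W | Np | U1 | U3 | M
  deriving DecidableEq

namespace CellI

/-- One-edge moves at the star of `b` (plus reflexivity/transitivity): `W → U1, U3, M`, `N′ → U1, M`,
`U1 → M`, `U3 → M`; `N′ → U3` is impossible (an open `b`–`c` path through the new edge would be a support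
path avoiding `C_a`), and `W`, `N′` are incomparable (whether `V(C_a)` separates `b` from `c` in the support
does not depend on the edges at `b`). -/
def le : CellI → CellI → Bool
  | W, W => true
  | W, U1 => true
  | W, U3 => true
  | W, M => true
  | Np, Np => true
  | Np, U1 => true
  | Np, M => true
  | U1, U1 => true
  | U1, M => true
  | U3, U3 => true
  | U3, M => true
  | M, M => true
  | _, _ => false

/-- The move order on `CellI` as a `≤`. -/
instance instLE : LE CellI := ⟨fun x y => le x y = true⟩

/-- The move order is decidable (it is a Boolean table). -/
instance instDecidableLE (x y : CellI) : Decidable (x ≤ y) :=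
  inferInstanceAs (Decidable (le x y = true))

/-- The move relation is a preorder. -/
instance instPreorder : Preorder CellI where
  le := (· ≤ ·)
  le_refl := by intro x; cases x <;> decide
  le_trans := by intro x y z; cases x <;> cases y <;> cases z <;> decide

/-- The kernel of `Γ` (twice its polar form) restricted to the case-I cells: `+1` on `{W, N′} × {M}` (both
orders), `−1` on the pairs `{U1, U3}` and `{N′, U3}`, `0` otherwise. -/
def kappaI : CellI → CellI → ℤ
  | W, M => 1
  | M, W => 1
  | Np, M => 1
  | M, Np => 1
  | U1, U3 => -1
  | U3, U1 => -1
  | Np, U3 => -1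
  | U3, Np => -1
  | _, _ => 0

/-- `kappaI` is submodular on every rectangle of comparable pairs of `CellI` (625 cases). -/
theorem kappaI_submod (a₀ a₁ b₀ b₁ : CellI) (ha : a₀ ≤ a₁) (hb : b₀ ≤ b₁) :
    kappaI a₁ b₁ + kappaI a₀ b₀ ≤ kappaI a₁ b₀ + kappaI a₀ b₁ := by
  revert ha hb
  cases a₀ <;> cases a₁ <;> cases b₀ <;> cases b₁ <;> decide

/-- `kappaI` is also nonnegative on comparable pairs (not needed below, recorded for the nested machine). -/
theorem kappaI_nonneg_of_le (x y : CellI) (h : x ≤ y) : 0 ≤ kappaI x y := by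
  revert h; cases x <;> cases y <;> decide

end CellI

open CellI in
/-- **(P2) of COMB-GAMMA §4.**  For two monotone case-I hit functions `φ ψ : Finset α → CellI` (the cells
of `Z ∪ V` and of `Y ∪ V` as the set `V` of open edges at `b` varies), the same-case star-deficit term is
nonnegative: `0 ≤ Σ_{V ⊆ S} (κ(φ V, ψ (S ∖ V)) − κ(φ V, ψ V))`. -/
theorem caseI_starTerm_nonneg (S : Finset α) (φ ψ : Finset α → CellI)
    (hφ : ∀ ⦃X Y : Finset α⦄, X ⊆ Y → φ X ≤ φ Y) (hψ : ∀ ⦃X Y : Finset α⦄, X ⊆ Y → ψ X ≤ ψ Y) :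
    0 ≤ ∑ V ∈ S.powerset, (kappaI (φ V) (ψ (S \ V)) - kappaI (φ V) (ψ V)) :=
  starTerm_nonneg kappaI (fun a₀ a₁ b₀ b₁ ha hb => kappaI_submod a₀ a₁ b₀ b₁ ha hb) S φ ψ hφ hψ

/-! ### The star-split induction principle -/

section StarInduction

variable [AddCommMonoid R] [PartialOrder R] [IsOrderedAddMonoid R]

/-- The antipodal sum of a cell map `c` over the interval with frozen-open set `al` and free set `D`:
`A(al, D) = Σ_{X ⊆ D} κ (c (al ∪ X)) (c (al ∪ (D ∖ X)))`. -/
def intervalSum (κ : Q → Q → R) (c : Finset α → Q) (al D : Finset α) : R :=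
  ∑ X ∈ D.powerset, κ (c (al ∪ X)) (c (al ∪ (D \ X)))

/-- **Star-split induction principle.**  Suppose that for every interval `(al, D)` either
`0 ≤ A(al, D)` is known outright, or there is a nonempty `T ⊆ D` with the star-split inequality
`Σ_{V ⊆ T} A(al ∪ V, D ∖ T) ≤ A(al, D)`.  Then `0 ≤ A(al, D)` for every interval.
(In the application `T` = the free edges at the cluster of a terminal; the base case is the interval with no
such edge, where `A = 0`.) -/
theorem starInduction (κ : Q → Q → R) (c : Finset α → Q)
    (h : ∀ al D : Finset α, 0 ≤ intervalSum κ c al D ∨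
      ∃ T ⊆ D, T.Nonempty ∧
        ∑ V ∈ T.powerset, intervalSum κ c (al ∪ V) (D \ T) ≤ intervalSum κ c al D) :
    ∀ al D : Finset α, 0 ≤ intervalSum κ c al D := by
  intro al D
  induction hn : D.card using Nat.strong_induction_on generalizing al D with
  | _ n ih =>
    rcases h al D with hpos | ⟨T, hTD, hTne, hle⟩
    · exact hpos
    · refine le_trans (sum_nonneg fun V _ => ?_) hle
      have hlt : (D \ T).card < n := by
        rw [← hn]
        exact card_lt_card (sdiff_ssubset hTD hTne)
      exact ih _ hlt (al ∪ V) (D \ T) rfl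

end StarInduction

end AntipodalDominance

end Summit.CriticalPhenomena.PercolationContinuityZ3.Theorems
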